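import Summits.QuantumAdvantage.QuantumAdvantage.Theorems.CubicForrelationNearExactIsExactCubicFormCells
import Summits.QuantumAdvantage.QuantumAdvantage.Theorems.CubicForrelationNearExactIsExactCubicFormTriple

/-!
# Crux `CubicForrelation.NearExactIsExact` (stmt-QuantumAdvantage-14043) — the FIBRE FORMULA for a cell with cubic form `T = y₀y₁y₂`
  (cell lemma L-T, first step: E1280-HANDPROOFS App. A.3 (FIB))

Certificate seat `b2b-cforr-cert` (gen 41).  HONEST FRAMING: kernel-checked bookkeeping (standard axioms).  A function `f` on `3 + m` bits
whose third differences are those of the monomial `y₀y₁y₂` (the descendant `T` of the light-cell analysis, in the coordinates of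
…CubicFormLightCoords with `h = 1` after moving the three `T`-coordinates to the front) is `y₀y₁y₂ ⊕ Q` with `Q` of vanishing third
differences (degree `≤ 2`, …CubicFormThirdZero), and its weight splits over the eight fibres `u ∈ 𝔽₂³`:
`#f + #Q_{111} = Σ_{u ≠ 111} #Q_u + 2^m` (`Q_u = Q(u, ·)`), i.e. `wt f = Σ_{u≠111} wt(Q_u) + (2^m − wt(Q_{111}))`.  This is formula (FIB)
of HOME/b2b-cforr-cert-g39/E1280-HANDPROOFS.md App. A.3, the entry point of cell lemma L-T (types `(h, r̄)`); the case analysis itself is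
not in this file.  Nothing about `θ₁₂`; NOT summit progress.

* `tfb_parity_unit`: `⟨y, eᵢ⟩ = yᵢ`.
* `tfb_fibre_formula` (**main**).

References: E1280-HANDPROOFS.md App. A.3.  Axioms: the standard three.
-/

set_option linter.dupNamespace false -- D-0017: single-problem summit ⇒ `QuantumAdvantage.QuantumAdvantage` by design

namespace Summit.QuantumAdvantage.QuantumAdvantage.Theorems.CubicForrelation.NearExactIsExact

open Finset
open Literature.Computability.QuantumComplexity.BuzetChailloux (bxor zeroVec allOnes)

/-- The parity of `y` against a unit vector is the coordinate. [folklore] -/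
theorem tfb_parity_unit {n : ℕ} (y : Fin n → Bool) (i : Fin n) :
    decide (Odd #(univ.filter fun j => y j && (fun l : Fin n => decide (l = i)) j)) = y i := by
  have hset : (univ.filter fun j => y j && (fun l : Fin n => decide (l = i)) j) = if y i = true then {i} else ∅ := by
    ext j
    simp only [mem_filter, mem_univ, true_and, Bool.and_eq_true, decide_eq_true_eq]
    by_cases hy : y i = true
    · rw [if_pos hy, mem_singleton]
      exact ⟨fun ⟨_, h2⟩ => h2, fun h => ⟨h ▸ hy, h⟩⟩
    · rw [if_neg hy]
      simp only [notMem_empty, iff_false, not_and]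
      intro h1 h2; rw [h2] at h1; exact hy h1
  rw [hset]
  cases y i <;> simp

/-- **The fibre formula for `T = y₀y₁y₂`.**  See the module docstring. [this work] -/
theorem tfb_fibre_formula {m : ℕ} (f : (Fin (3 + m) → Bool) → Bool)
    (hT : ∀ u v w x : Fin (3 + m) → Bool,
      (((f x ^^ f (bxor x w)) ^^ (f (bxor x v) ^^ f (bxor (bxor x v) w))) ^^
          ((f (bxor x u) ^^ f (bxor (bxor x u) w)) ^^ (f (bxor (bxor x u) v) ^^ f (bxor (bxor (bxor x u) v) w)))) =
        ((((u (Fin.castAdd m 0) && (v (Fin.castAdd m 1) && w (Fin.castAdd m 2))) ^^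
              (u (Fin.castAdd m 0) && (v (Fin.castAdd m 2) && w (Fin.castAdd m 1)))) ^^
            ((u (Fin.castAdd m 1) && (v (Fin.castAdd m 0) && w (Fin.castAdd m 2))) ^^
              (u (Fin.castAdd m 1) && (v (Fin.castAdd m 2) && w (Fin.castAdd m 0))))) ^^
          ((u (Fin.castAdd m 2) && (v (Fin.castAdd m 0) && w (Fin.castAdd m 1))) ^^
            (u (Fin.castAdd m 2) && (v (Fin.castAdd m 1) && w (Fin.castAdd m 0)))))) :
    let Q : (Fin (3 + m) → Bool) → Bool := fun z => f z ^^ ((z (Fin.castAdd m 0) && z (Fin.castAdd m 1)) && z (Fin.castAdd m 2))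
    (∀ u v w x : Fin (3 + m) → Bool,
      (((Q x ^^ Q (bxor x w)) ^^ (Q (bxor x v) ^^ Q (bxor (bxor x v) w))) ^^
          ((Q (bxor x u) ^^ Q (bxor (bxor x u) w)) ^^ (Q (bxor (bxor x u) v) ^^ Q (bxor (bxor (bxor x u) v) w)))) = false) ∧
    #(univ.filter fun y : Fin (3 + m) → Bool => f y = true) + #(univ.filter fun s : Fin m → Bool => Q (Fin.append allOnes s) = true) =
      (∑ v ∈ (univ : Finset (Fin 3 → Bool)).erase allOnes, #(univ.filter fun s : Fin m → Bool => Q (Fin.append v s) = true)) + 2 ^ m := by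
  classical
  intro Q
  -- the cubic form of the monomial `y₀y₁y₂`
  have hmono : ∀ z : Fin (3 + m) → Bool, ((z (Fin.castAdd m 0) && z (Fin.castAdd m 1)) && z (Fin.castAdd m 2)) =
      ((decide (decide (Odd #(univ.filter fun j => z j && (fun l : Fin (3 + m) => decide (l = Fin.castAdd m 0)) j)) = true) &&
        decide (decide (Odd #(univ.filter fun j => z j && (fun l : Fin (3 + m) => decide (l = Fin.castAdd m 1)) j)) = true)) &&
        decide (decide (Odd #(univ.filter fun j => z j && (fun l : Fin (3 + m) => decide (l = Fin.castAdd m 2)) j)) = true)) := by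
    intro z
    simp only [tfb_parity_unit, Bool.decide_eq_true]
  have h3 : ∀ u v w x : Fin (3 + m) → Bool,
      (((Q x ^^ Q (bxor x w)) ^^ (Q (bxor x v) ^^ Q (bxor (bxor x v) w))) ^^
          ((Q (bxor x u) ^^ Q (bxor (bxor x u) w)) ^^ (Q (bxor (bxor x u) v) ^^ Q (bxor (bxor (bxor x u) v) w)))) = false := by
    intro u v w x
    have hx : ∀ (a₁ a₂ a₃ a₄ a₅ a₆ a₇ a₈ c₁ c₂ c₃ c₄ c₅ c₆ c₇ c₈ : Bool),
        ((((a₁ ^^ c₁) ^^ (a₂ ^^ c₂)) ^^ ((a₃ ^^ c₃) ^^ (a₄ ^^ c₄))) ^^ (((a₅ ^^ c₅) ^^ (a₆ ^^ c₆)) ^^ ((a₇ ^^ c₇) ^^ (a₈ ^^ c₈)))) =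
        ((((a₁ ^^ a₂) ^^ (a₃ ^^ a₄)) ^^ ((a₅ ^^ a₆) ^^ (a₇ ^^ a₈))) ^^ (((c₁ ^^ c₂) ^^ (c₃ ^^ c₄)) ^^ ((c₅ ^^ c₆) ^^ (c₇ ^^ c₈)))) := by
      decide
    simp only [Q]
    rw [hx, hT]
    have hP := tct3_third_triple_product (fun l : Fin (3 + m) => decide (l = Fin.castAdd m 0)) (fun l => decide (l = Fin.castAdd m 1))
      (fun l => decide (l = Fin.castAdd m 2)) true true true u v w x
    simp only [tfb_parity_unit, Bool.decide_eq_true] at hP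
    rw [hP]
    generalize u (Fin.castAdd m 0) = u₀; generalize u (Fin.castAdd m 1) = u₁; generalize u (Fin.castAdd m 2) = u₂
    generalize v (Fin.castAdd m 0) = v₀; generalize v (Fin.castAdd m 1) = v₁; generalize v (Fin.castAdd m 2) = v₂
    generalize w (Fin.castAdd m 0) = w₀; generalize w (Fin.castAdd m 1) = w₁; generalize w (Fin.castAdd m 2) = w₂
    revert u₀ u₁ u₂ v₀ v₁ v₂ w₀ w₁ w₂
    decide
  refine ⟨h3, ?_⟩
  -- the fibres
  have happ : ∀ (v : Fin 3 → Bool) (s : Fin m → Bool) (t : Fin 3), Fin.append v s (Fin.castAdd m t) = v t :=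
    fun v s t => Fin.append_left v s t
  have hfib : ∀ v : Fin 3 → Bool, v ≠ allOnes →
      (univ.filter fun s : Fin m → Bool => f (Fin.append v s) = true) = univ.filter fun s : Fin m → Bool => Q (Fin.append v s) = true := by
    intro v hv
    have hv' : ((v 0 && v 1) && v 2) = false := by
      by_contra hc
      rw [Bool.not_eq_false, Bool.and_eq_true, Bool.and_eq_true] at hc
      obtain ⟨⟨h0, h1⟩, h2⟩ := hc
      apply hv
      funext t
      fin_cases t
      · simpa [allOnes] using h0
      · simpa [allOnes] using h1
      · simpa [allOnes] using h2
    refine filter_congr fun s _ => ?_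
    simp only [Q, happ]
    rw [hv', Bool.xor_false]
  have hones : #(univ.filter fun s : Fin m → Bool => f (Fin.append allOnes s) = true) +
      #(univ.filter fun s : Fin m → Bool => Q (Fin.append allOnes s) = true) = 2 ^ m := by
    have hQ1 : ∀ s, Q (Fin.append allOnes s) = !f (Fin.append allOnes s) := by
      intro s; simp only [Q, happ, allOnes, Bool.and_self, Bool.xor_true]
    simp only [hQ1]
    have e := card_filter_add_card_filter_not (s := (univ : Finset (Fin m → Bool))) (fun s => f (Fin.append allOnes s) = true)
    have hneg : (univ.filter fun s : Fin m → Bool => ¬ f (Fin.append allOnes s) = true) =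
        univ.filter fun s : Fin m → Bool => (!f (Fin.append allOnes s)) = true :=
      filter_congr fun s _ => by cases f (Fin.append allOnes s) <;> simp
    rw [hneg, card_univ, Fintype.card_fun, Fintype.card_bool, Fintype.card_fin] at e
    exact e
  rw [tcc_card_cells f, ← Finset.sum_erase_add _ _ (mem_univ allOnes)]
  have hsum : (∑ v ∈ (univ : Finset (Fin 3 → Bool)).erase allOnes, #(univ.filter fun s : Fin m → Bool => f (Fin.append v s) = true)) =
      ∑ v ∈ (univ : Finset (Fin 3 → Bool)).erase allOnes, #(univ.filter fun s : Fin m → Bool => Q (Fin.append v s) = true) :=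
    sum_congr rfl fun v hv => by rw [hfib v (ne_of_mem_erase hv)]
  rw [hsum]
  omega

end Summit.QuantumAdvantage.QuantumAdvantage.Theorems.CubicForrelation.NearExactIsExact
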